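import Mathlib

/-!
# Smyth's theorem, isolation of `θ₀` — Lemma 12.17 (venture `DiscreteObjects`, target L)

Cell `pub-namedobj`, seat `pub-namedobj-mahler` (gen 9). Framing: lottery ticket; floor = certified
bounds/negative ranges.

Fourth piece of the isolation part of [McKee–Smyth, *Around the Unit Circle*, Thm 12.1] (case `ℓ ≥ 2k`,
§12.2.4, Lemma 12.17), pure real arithmetic.  Data: `c = f₀ = g₀ = 1/M(P)`, the Taylor coefficients
`F_k, G_k, F_{2k}, G_{2k}` of the Smyth pair `f, g`, the sign `a = a_k = ±1`, and the constant
`C = θ₀⁻¹` (so `C² + C³ = 1`, `0.7548 < C < 0.7549`).  Hypotheses: the relations (12.7) `F_k = G_k + a c`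
and (12.14) `F_{2k} = G_{2k} + a G_k`, Prop. 12.11(b) `|F_k| ≤ 1 - c²`, Prop. 12.11(d) for `f` and
`g` (12.15), and `3/4 ≤ c < 1`.  Conclusions (with `δ = C - c`):

* `c ≤ C` (this is Smyth's inequality `c² + c³ ≤ 1` again);
* (12.23) `|F_k - a(1 - c²)| ≤ 6δ`;  (12.24) `|G_k + a(c² + c - 1)| ≤ 6δ`;  (12.25) `|G_{2k}| ≤ 28δ`.

The proof is sign-free in the variable `x := a F_k = |F_k|` (then `G_k = a(x - c)`, `F_{2k} = G_{2k} + x - c`).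
-/

namespace Summit.Ventures.DiscreteObjects.Mahler

/-- (12.20), multiplied by `C`: `C(1 - c² - c³) = (C - c)(1 + cC + cC² + c²C)` when `C² + C³ = 1`. -/
theorem smyth_isolation_identity_12_20 {c C : ℝ} (hC : C ^ 2 + C ^ 3 = 1) :
    C * (1 - c ^ 2 - c ^ 3) = (C - c) * (1 + c * C + c * C ^ 2 + c ^ 2 * C) := by
  linear_combination (-c) * hC

/-- If `c² + c³ ≤ 1 = C² + C³` with `c, C ≥ 0` then `c ≤ C`. -/
theorem le_of_sq_add_cube_le {c C : ℝ} (hc : 0 ≤ c) (hC0 : 0 ≤ C) (hC : C ^ 2 + C ^ 3 = 1)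
    (h : c ^ 2 + c ^ 3 ≤ 1) : c ≤ C := by
  by_contra hlt
  push Not at hlt
  have h1 : C ^ 2 < c ^ 2 := by nlinarith
  have h2 : C ^ 3 < c ^ 3 := by nlinarith [mul_pos (by linarith : (0 : ℝ) < c - C) (by nlinarith : (0 : ℝ) < c ^ 2 + c * C + C ^ 2 + 1)]
  linarith

/-- The core of (12.18)–(12.19), denominators cleared and sign-free (`x = |F_k|`, `y = 1 - c² - x`):
`1 - c² - c³ ≥ 0` and `(5c - 3)·y ≤ 1 - c² - c³`. -/
theorem smyth_12_19_core {c x F2k G2k : ℝ} (hc : 3 / 4 ≤ c) (hc1 : c < 1) (hxhi : x ≤ 1 - c ^ 2)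
    (hF2G2 : F2k = G2k + (x - c)) (hF2b : -(1 - c ^ 2) + x ^ 2 / (1 + c) ≤ F2k)
    (hG2a : G2k ≤ 1 - c ^ 2 - (c - x) ^ 2 / (1 - c)) :
    0 ≤ 1 - c ^ 2 - c ^ 3 ∧ (5 * c - 3) * (1 - c ^ 2 - x) ≤ 1 - c ^ 2 - c ^ 3 := by
  have h1c : 0 < 1 - c := by linarith
  have h1c' : 0 < 1 + c := by linarith
  have hlo : -(1 - c ^ 2) * (1 + c) + x ^ 2 ≤ F2k * (1 + c) := by
    have e : (-(1 - c ^ 2) + x ^ 2 / (1 + c)) * (1 + c) = -(1 - c ^ 2) * (1 + c) + x ^ 2 := by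
      field_simp
    rw [← e]; exact mul_le_mul_of_nonneg_right hF2b h1c'.le
  have hGup : G2k * (1 - c) ≤ (1 - c ^ 2) * (1 - c) - (c - x) ^ 2 := by
    have e : (1 - c ^ 2 - (c - x) ^ 2 / (1 - c)) * (1 - c) = (1 - c ^ 2) * (1 - c) - (c - x) ^ 2 := by
      field_simp
    rw [← e]; exact mul_le_mul_of_nonneg_right hG2a h1c.le
  -- (12.18), denominators cleared
  have key : (c - x) * (1 - c ^ 2) ≤ 2 * (1 - c ^ 2) ^ 2 - x ^ 2 * (1 - c) - (c - x) ^ 2 * (1 + c) := by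
    have h1 : (-(1 - c ^ 2) * (1 + c) + x ^ 2) * (1 - c) ≤ F2k * (1 + c) * (1 - c) :=
      mul_le_mul_of_nonneg_right hlo h1c.le
    have h2 : G2k * (1 - c) * (1 + c) ≤ ((1 - c ^ 2) * (1 - c) - (c - x) ^ 2) * (1 + c) :=
      mul_le_mul_of_nonneg_right hGup h1c'.le
    have h3 : F2k * (1 + c) * (1 - c) = G2k * (1 - c) * (1 + c) + (x - c) * (1 - c ^ 2) := by
      rw [hF2G2]; ring
    linarith only [h1, h2, h3]
  -- with `y := 1 - c² - x ≥ 0`: `2y² + (5c-3)(1+c)y ≤ (1+c)(1-c²-c³)`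
  obtain ⟨y, rfl⟩ : ∃ y : ℝ, x = 1 - c ^ 2 - y := ⟨1 - c ^ 2 - x, by ring⟩
  have hy0 : 0 ≤ y := by linarith only [hxhi]
  have hy2 : 2 * y ^ 2 + (5 * c - 3) * (1 + c) * y ≤ (1 + c) * (1 - c ^ 2 - c ^ 3) := by
    linarith only [key]
  have h53 : 0 ≤ 5 * c - 3 := by linarith only [hc]
  have hprod : 0 ≤ (5 * c - 3) * (1 + c) * y := mul_nonneg (mul_nonneg h53 h1c'.le) hy0
  constructor
  · have h1 : 0 ≤ (1 + c) * (1 - c ^ 2 - c ^ 3) := by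
      linarith only [hy2, hprod, sq_nonneg y]
    by_contra hneg
    push Not at hneg
    linarith only [mul_neg_of_pos_of_neg h1c' hneg, h1]
  · have e : 1 - c ^ 2 - (1 - c ^ 2 - y) = y := by ring
    rw [e]
    have h6 : (1 + c) * ((5 * c - 3) * y) ≤ (1 + c) * (1 - c ^ 2 - c ^ 3) := by
      linarith only [hy2, sq_nonneg y]
    exact le_of_mul_le_mul_left h6 h1c'

/-- `-c(1-c²) - 2(1-c)y ≤ F_{2k} ≤ -c(1-c²) + 2(1+c)y` (Prop. 12.11(d) rewritten around `x = 1 - c² - y`). -/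
theorem smyth_F2k_bounds {c y F2k : ℝ} (hc : 3 / 4 ≤ c) (hc1 : c < 1)
    (hF2a : F2k ≤ 1 - c ^ 2 - (1 - c ^ 2 - y) ^ 2 / (1 - c))
    (hF2b : -(1 - c ^ 2) + (1 - c ^ 2 - y) ^ 2 / (1 + c) ≤ F2k) :
    -c * (1 - c ^ 2) - 2 * (1 - c) * y ≤ F2k ∧ F2k ≤ -c * (1 - c ^ 2) + 2 * (1 + c) * y := by
  have h1c : 0 < 1 - c := by linarith
  have h1c' : 0 < 1 + c := by linarith
  have hup : F2k * (1 - c) ≤ (1 - c ^ 2) * (1 - c) - (1 - c ^ 2 - y) ^ 2 := by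
    have e : (1 - c ^ 2 - (1 - c ^ 2 - y) ^ 2 / (1 - c)) * (1 - c) =
        (1 - c ^ 2) * (1 - c) - (1 - c ^ 2 - y) ^ 2 := by
      field_simp
    rw [← e]; exact mul_le_mul_of_nonneg_right hF2a h1c.le
  have hlo : -(1 - c ^ 2) * (1 + c) + (1 - c ^ 2 - y) ^ 2 ≤ F2k * (1 + c) := by
    have e : (-(1 - c ^ 2) + (1 - c ^ 2 - y) ^ 2 / (1 + c)) * (1 + c) =
        -(1 - c ^ 2) * (1 + c) + (1 - c ^ 2 - y) ^ 2 := by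
      field_simp
    rw [← e]; exact mul_le_mul_of_nonneg_right hF2b h1c'.le
  constructor
  · have h8 : y ^ 2 ≤ (1 + c) * (F2k - (-c * (1 - c ^ 2) - 2 * (1 - c) * y)) := by
      linarith only [hlo]
    by_contra hneg
    push Not at hneg
    linarith only [mul_pos h1c' (sub_pos.mpr hneg), sq_nonneg y, h8]
  · have h7 : (1 - c) * (F2k - (-c * (1 - c ^ 2) + 2 * (1 + c) * y)) ≤ -y ^ 2 := by
      linarith only [hup]
    by_contra hneg
    push Not at hneg
    linarith only [mul_pos h1c (sub_pos.mpr hneg), sq_nonneg y, h7]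

/-- (12.26): `1 - c² - c³ ≤ 4(C - c)` for `0 ≤ c ≤ C`, `0.7548 < C < 0.7549`, `C² + C³ = 1`. -/
theorem smyth_12_26 {c C : ℝ} (hc0 : 0 ≤ c) (hcC : c ≤ C) (hC1 : 7548 / 10000 < C)
    (hC2 : C < 7549 / 10000) (hCeq : C ^ 2 + C ^ 3 = 1) (hX0 : 0 ≤ 1 - c ^ 2 - c ^ 3) :
    1 - c ^ 2 - c ^ 3 ≤ 4 * (C - c) := by
  have hδ : 0 ≤ C - c := by linarith
  have hC0 : 0 ≤ C := le_trans hc0 hcC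
  have hcC1 : c * C ≤ 1 := by nlinarith
  have hb : 1 + c * C + c * C ^ 2 + c ^ 2 * C ≤ 3 := by
    have h2 : c * C ^ 2 ≤ 7549 / 10000 := by nlinarith
    have h3 : c ^ 2 * C ≤ 7549 / 10000 := by nlinarith
    nlinarith
  have hid := smyth_isolation_identity_12_20 (c := c) hCeq
  have h3 : (C - c) * (1 + c * C + c * C ^ 2 + c ^ 2 * C) ≤ (C - c) * 3 :=
    mul_le_mul_of_nonneg_left hb hδ
  have h4 : C * (1 - c ^ 2 - c ^ 3) ≤ 3 * (C - c) := by rw [hid]; linarith only [h3]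
  have h5 : 7548 / 10000 * (1 - c ^ 2 - c ^ 3) ≤ C * (1 - c ^ 2 - c ^ 3) :=
    mul_le_mul_of_nonneg_right hC1.le hX0
  linarith only [h4, h5, hδ, hX0]

/-- **Lemma 12.17** ([McKee–Smyth, (12.23)–(12.25)], with the preliminary `c ≤ C`).  See the module
docstring for the meaning of the hypotheses. -/
theorem smyth_lemma_12_17 {c C a Fk Gk F2k G2k : ℝ} (ha : a = 1 ∨ a = -1) (hc : 3 / 4 ≤ c) (hc1 : c < 1)
    (hC1 : 7548 / 10000 < C) (hC2 : C < 7549 / 10000) (hCeq : C ^ 2 + C ^ 3 = 1)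
    (hFb : |Fk| ≤ 1 - c ^ 2) (hrelk : Fk = Gk + a * c) (hrel2k : F2k = G2k + a * Gk)
    (hF2 : F2k ≤ 1 - c ^ 2 - Fk ^ 2 / (1 - c) ∧ -(1 - c ^ 2) + Fk ^ 2 / (1 + c) ≤ F2k)
    (hG2 : G2k ≤ 1 - c ^ 2 - Gk ^ 2 / (1 - c) ∧ -(1 - c ^ 2) + Gk ^ 2 / (1 + c) ≤ G2k) :
    c ≤ C ∧ |Fk - a * (1 - c ^ 2)| ≤ 6 * (C - c) ∧ |Gk + a * (c ^ 2 + c - 1)| ≤ 6 * (C - c) ∧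
      |G2k| ≤ 28 * (C - c) := by
  have haa : a * a = 1 := by rcases ha with h | h <;> subst h <;> norm_num
  have ha2 : a ^ 2 = 1 := by rw [sq]; exact haa
  have habs : |a| = 1 := by rcases ha with h | h <;> subst h <;> norm_num
  -- the sign-free variable `x = a F_k = |F_k|`
  obtain ⟨x, hx⟩ : ∃ x : ℝ, x = a * Fk := ⟨_, rfl⟩
  have hFk : Fk = a * x := by rw [hx, ← mul_assoc, haa, one_mul]
  have hGk : Gk = a * (x - c) := by rw [mul_sub, ← hFk]; linarith only [hrelk]
  have hx2 : Fk ^ 2 = x ^ 2 := by rw [hFk, mul_pow, ha2, one_mul]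
  have hGk2 : Gk ^ 2 = (c - x) ^ 2 := by rw [hGk, mul_pow, ha2, one_mul]; ring
  have hxabs : |x| ≤ 1 - c ^ 2 := by rw [hx, abs_mul, habs, one_mul]; exact hFb
  obtain ⟨hxlo, hxhi⟩ := abs_le.mp hxabs
  have hF2G2 : F2k = G2k + (x - c) := by rw [hrel2k, hGk, ← mul_assoc, haa, one_mul]
  obtain ⟨hF2a, hF2b⟩ := hF2
  obtain ⟨hG2a, hG2b⟩ := hG2
  rw [hx2] at hF2a hF2b
  rw [hGk2] at hG2a hG2b
  obtain ⟨hX0, h14⟩ := smyth_12_19_core hc hc1 hxhi hF2G2 hF2b hG2a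
  have hcC : c ≤ C := le_of_sq_add_cube_le (by linarith) (by linarith) hCeq (by linarith only [hX0])
  have hδ : 0 ≤ C - c := by linarith only [hcC]
  have hX4 := smyth_12_26 (by linarith) hcC hC1 hC2 hCeq hX0
  -- `y := 1 - c² - x`, `0 ≤ y ≤ 6δ`
  obtain ⟨y, rfl⟩ : ∃ y : ℝ, x = 1 - c ^ 2 - y := ⟨1 - c ^ 2 - x, by ring⟩
  have hy0 : 0 ≤ y := by linarith only [hxhi]
  have e : 1 - c ^ 2 - (1 - c ^ 2 - y) = y := by ring
  rw [e] at h14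
  have hy6 : y ≤ 6 * (C - c) := by
    have : 3 / 4 * y ≤ (5 * c - 3) * y := mul_le_mul_of_nonneg_right (by linarith only [hc]) hy0
    linarith only [this, h14, hX4, hδ]
  refine ⟨hcC, ?_, ?_, ?_⟩
  · -- (12.23)
    have : Fk - a * (1 - c ^ 2) = a * (-y) := by rw [hFk]; ring
    rw [this, abs_mul, habs, one_mul, abs_neg, abs_of_nonneg hy0]; exact hy6
  · -- (12.24)
    have : Gk + a * (c ^ 2 + c - 1) = a * (-y) := by rw [hGk]; ring
    rw [this, abs_mul, habs, one_mul, abs_neg, abs_of_nonneg hy0]; exact hy6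
  · -- (12.25)
    obtain ⟨hF2lo, hF2up⟩ := smyth_F2k_bounds hc hc1 hF2a hF2b
    have hG2eq : G2k = F2k - (1 - c ^ 2) + y + c := by rw [hF2G2]; ring
    have hcy : c * y ≤ 7549 / 10000 * y := mul_le_mul_of_nonneg_right (hcC.trans hC2.le) hy0
    have hcy0 : 0 ≤ c * y := mul_nonneg (by linarith) hy0
    rw [abs_le, hG2eq]
    constructor
    · linarith only [hF2lo, hX4, hy6, hcy0, hδ, hy0]
    · linarith only [hF2up, hX0, hcy, hy6, hδ]

end Summit.Ventures.DiscreteObjects.Mahler
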